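import Mathlib
import Literature.Computability.AlgebraicComplexity.NestFreeMatchingPoly
import Literature.Computability.AlgebraicComplexity.ArithCircuitProofs
import Summits.ValiantsHypothesis.ValiantsHypothesis.Theorems.FifoMatchingNNDivisionHardLinearTransport
import Summits.ValiantsHypothesis.ValiantsHypothesis.Theorems.FifoMatchingNNDivisionHardSplitFaceGluing
import Summits.ValiantsHypothesis.ValiantsHypothesis.Theorems.FifoMatchingNNMonomialCofactorHard
import HarnessLib

/-!
# Route FifoMatching — crux `NNDivisionHard` (stmt-ValiantsHypothesis-21181): the SPLIT FACE of the nest-free matching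
# polynomial, II — the face identification and PREFIX / SUFFIX TRANSPORT of certificates at additive cost

For block sizes `b, c` (ambient `[0, 2(b+c))`, left block `L = [0, 2b)`, right block `R = [2b, 2(b+c))`) and the
left-internal direction `w = 𝟙_L` (weight `1` on the arc variables with both ends in `L`):

* (part I, `…NNDivisionHardSplitFaceGluing`: the `w`-weight of a perfect matching is `≤ b` with equality iff it stabilises
  `L`, and the block-stable nest-free perfect matchings are exactly the two-sided gluings `glue2 NL NR`;)
* `arcMonomial_glue2` — `x^{glue2 NL NR} = ι_L(x^{NL}) · ι_R(x^{NR})`;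
* ★★ `topComponent_lWeight` — **THE SPLIT FACE: `top_{𝟙_L}(NN_{b+c}) = ι_L(NN_b) · ι_R(NN_c)`**;
* ★★ `exists_prefix_transport`, `exists_suffix_transport` (and the `b ≤ n` / `c ≤ n` forms `…'`) — by the linear
  transport engine (`LinearTransport.linear_transport`): **for EVERY `b ≤ n` and every cofactor `h ≠ 0` there is `g ≠ 0`
  on the arcs of `[0, 2b)` with `L₊(NN_b · g) ≤ L₊(NN_n · h) + 1`, `L₊(g) ≤ L₊(h)`; and likewise on the suffix block.**
  The pinned-rainbow transport reached only `a ∈ [(n−1)/3, (n−1)/2]` (at quadratic cost before `…LinearTransport`);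
  here every prefix and every suffix is reached in ONE step at cost `+1`, and every aligned interval block in two.

HONEST FRAMING: a self-reduction of the certificate problem across scales (the set of `n` for which `NN_n` has a certificate
of cost `≤ L` is downward closed up to `+1`); by itself not a lower bound.  stmt-21181 stays OPEN; nothing here bears on
`NNNotVP` or on VP ≠ VNP (NOT proved).
References: Chen–Deng–Du–Stanley–Yan 2007 §1 [ChenDengDuStanleyYan2007]; Bürgisser 2000 Rem. 2.7 [Burgisser2000];
Hrubeš–Yehudayoff 2021 §6 Problem 2 [HrubesYehudayoff2021].
-/

noncomputable section

-- Sub = Summit single-conjunct layout: the duplicated namespace component is mandated by the tree.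
set_option linter.dupNamespace false
set_option autoImplicit false

namespace Summit.ValiantsHypothesis.ValiantsHypothesis.Theorems.FifoMatching.NNDivisionHard.SplitFace

open Finset MvPolynomial Literature.Computability.AlgebraicComplexity
open Summit.ValiantsHypothesis.ValiantsHypothesis.Theorems.ZeroOneTransfer.Negative (topComponent)
open Summit.ValiantsHypothesis.ValiantsHypothesis.Theorems.FifoMatching.NNDivisionHard.StackPowersQueue
  (blockEmb blockEmb_injective restrictM filter_lt_eq_map topComponent_sum_arcMonomial shiftMatching shiftMatching_mem)
open Summit.ValiantsHypothesis.ValiantsHypothesis.Theorems.FifoMatching.NNDivisionHard.LinearTransport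
  (linear_transport)
open scoped NNReal BigOperators

variable {b c : ℕ}


/-! ### §4 The arc monomial of a gluing and the split face -/

/-- The right block of `univ` is the image of `Fin (2c)` under the shift. [folklore] -/
theorem filter_ge_eq_map :
    (univ : Finset (Fin (2 * (b + c)))).filter (fun i : Fin (2 * (b + c)) => ¬ (i : ℕ) < 2 * b) =
      (univ : Finset (Fin (2 * c))).map ⟨shiftR b c, shiftR_injective⟩ := by
  ext i
  simp only [Finset.mem_filter, Finset.mem_univ, true_and, Finset.mem_map, Function.Embedding.coeFn_mk, not_lt]
  constructor
  · intro hi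
    exact ⟨⟨(i : ℕ) - 2 * b, by have := i.isLt; omega⟩,
      Fin.ext (by change 2 * b + ((i : ℕ) - 2 * b) = (i : ℕ); omega)⟩
  · rintro ⟨j, rfl⟩
    exact le_shiftR j

/-- **`x^{glue2 NL NR} = ι_L(x^{NL}) · ι_R(x^{NR})`.** [folklore] -/
theorem arcMonomial_glue2 (NL : Fin (2 * b) → Fin (2 * b)) (NR : Fin (2 * c) → Fin (2 * c)) :
    arcMonomial ℝ≥0 (glue2 NL NR) =
      rename (blockEmb (two_mul_le b c)) (arcMonomial ℝ≥0 NL) * rename (blockEmbR b c) (arcMonomial ℝ≥0 NR) := by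
  unfold arcMonomial
  rw [← Finset.prod_filter_mul_prod_filter_not univ (fun i : Fin (2 * (b + c)) => (i : ℕ) < 2 * b)]
  congr 1
  · rw [filter_lt_eq_map (two_mul_le b c), Finset.prod_map, map_prod]
    refine Finset.prod_congr rfl fun j _ => ?_
    rw [Fin.castLEEmb_apply, glue2_castLE]
    by_cases h : j < NL j
    · rw [if_pos ((Fin.castLE_lt_castLE_iff _).2 h), if_pos h, rename_X]
      rfl
    · rw [if_neg (fun h' => h ((Fin.castLE_lt_castLE_iff _).1 h')), if_neg h, map_one]
  · have hlt : ∀ i j : Fin (2 * c), shiftR b c i < shiftR b c j ↔ i < j := fun i j => by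
      rw [Fin.lt_def, Fin.lt_def, val_shiftR, val_shiftR]; omega
    rw [filter_ge_eq_map, Finset.prod_map, map_prod]
    refine Finset.prod_congr rfl fun j _ => ?_
    rw [Function.Embedding.coeFn_mk, glue2_shiftR]
    by_cases h : j < NR j
    · rw [if_pos ((hlt _ _).2 h), if_pos h, rename_X]
      rfl
    · rw [if_neg (fun h' => h ((hlt _ _).1 h')), if_neg h, map_one]

/-- **The `𝟙_L`-maximal nest-free matchings are exactly the gluings.** [folklore] -/
theorem filter_max_eq_image :
    (nestFreeMatchings (2 * (b + c))).filter (fun M => Finsupp.weight (lWeight b c) (arcExponent M) = b) =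
      (nestFreeMatchings (2 * b) ×ˢ nestFreeMatchings (2 * c)).image (fun p => glue2 p.1 p.2) := by
  ext M
  rw [Finset.mem_filter, Finset.mem_image]
  constructor
  · rintro ⟨hM, hW⟩
    have hPM := nestFreeMatchings_subset_perfectMatchings hM
    have hst := (weight_eq_iff hPM).1 hW
    exact ⟨(restrictM (two_mul_le b c) M, restrictR b c M),
      Finset.mem_product.2 ⟨restrictM_mem' hM hst, restrictR_mem hM hst⟩, glue2_restrict hPM hst⟩
  · rintro ⟨⟨NL, NR⟩, hp, rfl⟩
    obtain ⟨hNL, hNR⟩ := Finset.mem_product.1 hp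
    have hG := glue2_mem hNL hNR
    exact ⟨hG, (weight_eq_iff (nestFreeMatchings_subset_perfectMatchings hG)).2 (glue2_stable NL NR)⟩

/-- Gluing is injective on pairs. [folklore] -/
theorem glue2_injective2 {NL NL' : Fin (2 * b) → Fin (2 * b)} {NR NR' : Fin (2 * c) → Fin (2 * c)}
    (h : glue2 NL NR = glue2 NL' NR') : NL = NL' ∧ NR = NR' :=
  ⟨by rw [← restrictM_glue2 NL NR, h, restrictM_glue2], by rw [← restrictR_glue2 NL NR, h, restrictR_glue2]⟩

/-- ★★ **THE SPLIT FACE: `top_{𝟙_L}(NN_{b+c}) = ι_L(NN_b) · ι_R(NN_c)`** — the nest-free perfect matchings with the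
maximal number `b` of arcs inside the left block are the gluings of a nest-free perfect matching of the left block with one
of the right block. [cite: ChenDengDuStanleyYan2007, §1] -/
theorem topComponent_lWeight :
    topComponent (lWeight b c) (nestFreeMatchingPoly (b + c) ℝ≥0) =
      rename (blockEmb (two_mul_le b c)) (nestFreeMatchingPoly b ℝ≥0) *
        rename (blockEmbR b c) (nestFreeMatchingPoly c ℝ≥0) := by
  have hG := glue2_mem (shiftMatching_mem b) (shiftMatching_mem c)
  rw [nestFreeMatchingPoly_eq_sum_arcMonomial,
    topComponent_sum_arcMonomial (lWeight b c) nestFreeMatchings_subset_perfectMatchings (W := b)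
      (fun M hM => weight_le (nestFreeMatchings_subset_perfectMatchings hM))
      ⟨glue2 (shiftMatching b) (shiftMatching c), hG,
        (weight_eq_iff (nestFreeMatchings_subset_perfectMatchings hG)).2 (glue2_stable _ _)⟩,
    filter_max_eq_image,
    Finset.sum_image fun p _ q _ h => Prod.ext (glue2_injective2 h).1 (glue2_injective2 h).2,
    Finset.sum_product, nestFreeMatchingPoly_eq_sum_arcMonomial, nestFreeMatchingPoly_eq_sum_arcMonomial, map_sum,
    map_sum, Finset.sum_mul_sum]
  exact Finset.sum_congr rfl fun NL _ => Finset.sum_congr rfl fun NR _ => arcMonomial_glue2 NL NR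

/-! ### §5 Prefix and suffix transport -/

/-- The right factor of the split face avoids the left block variables. [folklore] -/
theorem support_rename_blockEmbR_outside (Q : MvPolynomial (Fin (2 * c) × Fin (2 * c)) ℝ≥0) :
    ∀ m ∈ (rename (blockEmbR b c) Q).support, ∀ e ∈ m.support, e ∉ Set.range (blockEmb (two_mul_le b c)) := by
  classical
  intro m hm e he
  rw [support_rename_of_injective blockEmbR_injective, Finset.mem_image] at hm
  obtain ⟨d, -, rfl⟩ := hm
  obtain ⟨e', -, rfl⟩ := Finset.mem_image.1 (Finsupp.mapDomain_support he)
  rintro ⟨⟨i, j⟩, h⟩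
  have hv := congrArg (fun x : Fin (2 * (b + c)) × Fin (2 * (b + c)) => (x.1 : ℕ)) h
  simp only [blockEmb, blockEmbR, Prod.map_fst, Fin.val_castLE, val_shiftR] at hv
  have := i.isLt
  omega

/-- The left factor of the split face avoids the right block variables. [folklore] -/
theorem support_rename_blockEmb_outside (Q : MvPolynomial (Fin (2 * b) × Fin (2 * b)) ℝ≥0) :
    ∀ m ∈ (rename (blockEmb (two_mul_le b c)) Q).support, ∀ e ∈ m.support, e ∉ Set.range (blockEmbR b c) := by
  classical
  intro m hm e he
  rw [support_rename_of_injective (blockEmb_injective _), Finset.mem_image] at hm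
  obtain ⟨d, -, rfl⟩ := hm
  obtain ⟨e', -, rfl⟩ := Finset.mem_image.1 (Finsupp.mapDomain_support he)
  rintro ⟨⟨i, j⟩, h⟩
  have hv := congrArg (fun x : Fin (2 * (b + c)) × Fin (2 * (b + c)) => (x.1 : ℕ)) h
  simp only [blockEmb, blockEmbR, Prod.map_fst, Fin.val_castLE, val_shiftR] at hv
  have := e'.1.isLt
  omega

/-- ★★ **PREFIX TRANSPORT.**  Every certificate for `NN_{b+c}` restricts to one for the prefix block `NN_b` at additive
cost: for every `h ≠ 0` there is `g ≠ 0` on the arcs of `[0, 2b)` with `L₊(NN_b · g) ≤ L₊(NN_{b+c} · h) + 1` and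
`L₊(g) ≤ L₊(h)`. [cite: Burgisser2000, Rem. 2.7] [cite: ChenDengDuStanleyYan2007, §1] -/
theorem exists_prefix_transport {h : MvPolynomial (Fin (2 * (b + c)) × Fin (2 * (b + c))) ℝ≥0} (hh : h ≠ 0) :
    ∃ g : MvPolynomial (Fin (2 * b) × Fin (2 * b)) ℝ≥0, g ≠ 0 ∧
      complexity (nestFreeMatchingPoly b ℝ≥0 * g) ≤ complexity (nestFreeMatchingPoly (b + c) ℝ≥0 * h) + 1 ∧
      complexity g ≤ complexity h :=
  linear_transport (blockEmb_injective (two_mul_le b c)) (lWeight b c) topComponent_lWeight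
    (fun h0 => MonomialCofactor.nn_ne_zero c
      (rename_injective _ blockEmbR_injective (by rw [h0, map_zero])))
    (support_rename_blockEmbR_outside _) hh

/-- ★★ **SUFFIX TRANSPORT.**  Every certificate for `NN_{b+c}` restricts to one for the suffix block `NN_c` at additive
cost. [cite: Burgisser2000, Rem. 2.7] [cite: ChenDengDuStanleyYan2007, §1] -/
theorem exists_suffix_transport {h : MvPolynomial (Fin (2 * (b + c)) × Fin (2 * (b + c))) ℝ≥0} (hh : h ≠ 0) :
    ∃ g : MvPolynomial (Fin (2 * c) × Fin (2 * c)) ℝ≥0, g ≠ 0 ∧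
      complexity (nestFreeMatchingPoly c ℝ≥0 * g) ≤ complexity (nestFreeMatchingPoly (b + c) ℝ≥0 * h) + 1 ∧
      complexity g ≤ complexity h :=
  linear_transport blockEmbR_injective (lWeight b c) (topComponent_lWeight.trans (mul_comm _ _))
    (fun h0 => MonomialCofactor.nn_ne_zero b
      (rename_injective _ (blockEmb_injective (two_mul_le b c)) (by rw [h0, map_zero])))
    (support_rename_blockEmb_outside _) hh

/-- ★★ **PREFIX TRANSPORT, `b ≤ n` form.** [cite: Burgisser2000, Rem. 2.7] -/
theorem exists_prefix_transport' {n b : ℕ} (hb : b ≤ n)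
    {h : MvPolynomial (Fin (2 * n) × Fin (2 * n)) ℝ≥0} (hh : h ≠ 0) :
    ∃ g : MvPolynomial (Fin (2 * b) × Fin (2 * b)) ℝ≥0, g ≠ 0 ∧
      complexity (nestFreeMatchingPoly b ℝ≥0 * g) ≤ complexity (nestFreeMatchingPoly n ℝ≥0 * h) + 1 ∧
      complexity g ≤ complexity h := by
  obtain ⟨c, rfl⟩ := Nat.exists_eq_add_of_le hb
  exact exists_prefix_transport hh

/-- ★★ **SUFFIX TRANSPORT, `c ≤ n` form.** [cite: Burgisser2000, Rem. 2.7] -/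
theorem exists_suffix_transport' {n c : ℕ} (hc : c ≤ n)
    {h : MvPolynomial (Fin (2 * n) × Fin (2 * n)) ℝ≥0} (hh : h ≠ 0) :
    ∃ g : MvPolynomial (Fin (2 * c) × Fin (2 * c)) ℝ≥0, g ≠ 0 ∧
      complexity (nestFreeMatchingPoly c ℝ≥0 * g) ≤ complexity (nestFreeMatchingPoly n ℝ≥0 * h) + 1 ∧
      complexity g ≤ complexity h := by
  obtain ⟨b, rfl⟩ := Nat.exists_eq_add_of_le' hc
  exact exists_suffix_transport hh

end Summit.ValiantsHypothesis.ValiantsHypothesis.Theorems.FifoMatching.NNDivisionHard.SplitFace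

end
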